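import Literature.AlgebraicGeometry.Resolution.AlterationsFibresConnected
import Literature.AlgebraicGeometry.FundamentalGroup.ProjectiveLineSimplyConnectedHolds
import HarnessLib

/-!
# De Jong 1996, 4.12: "all fibres of `f` are geometrically connected" from its open leaves

Topic: `Literature/AlgebraicGeometry/Resolution`. Bookkeeping (pure composition, no new named
fact) for the named fact `DeJong1996FibresGeometricallyConnected` of `AlterationsLemma411.lean` —
de Jong 1996, 4.12 (p. 68, l. −2 to p. 69, l. 1):

> "Let `X' → Y' → ℙ^{d-1}` be the Stein factorization of `f`. Note that `Y' → ℙ^{d-1}` is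
> (finite) étale, in view of property (ii) b) of the lemma (cf. [18]). (The reader may
> circumvent this result by replacing `ℙ^{d-1}` by `Y'`.) We conclude that `Y' = ℙ^{d-1}`,
> hence all fibres of `f` are geometrically connected."

That fact is an interior node of the decomposition already in the tree: it is PROVED
(`DeJong1996FibresGeometricallyConnected.of_steinEtale_of_simplyConnected`,
`AlterationsFibresConnected.lean`) from Zariski's connectedness theorem in its Stein form
(`Literature.AlgebraicGeometry.Morphisms.steinFactorization_geometricallyConnected`, Stacks 03H2 (1)),
de Jong's sentence "`Y' → ℙ^{d-1}` is (finite) étale" (`DeJong1996SteinFactorizationEtale`) and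
SGA 1 XI 1.1 (`ProjectiveSpaceSimplyConnected`), the last being equivalent
(`FundamentalGroup.projectiveSpaceSimplyConnected_iff`) to its case `r = 1`
(`FundamentalGroup.ProjectiveLineSimplyConnected`, now PROVED:
`FundamentalGroup.ProjectiveLineSimplyConnected_holds`, Riemann–Hurwitz) together with X 2.11
for projective space (`FundamentalGroup.EtaleCoverHyperplaneSectionConnected`). Feeding the
discharge in leaves exactly THREE open named facts below the sentence, recorded as the single
implication `DeJong1996FibresGeometricallyConnected.of_openLeaves`; its discharge
`DeJong1996FibresGeometricallyConnected_holds` is that term fed with the three `…_holds`.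
For `d ≤ 1` (curves over `ℙ⁰`, surfaces over `ℙ¹`) the third leaf is not needed:
`DeJong1996.IsLemma411Fibration.geometricallyConnected_of_le_one` (the cases `r = 0, 1` of
SGA 1 XI 1.1 are proved in the tree).

Remarks for the reader of the trust base. (1) The parenthetical remark of the source is carried
out in the tree: `DeJong1996FibrationReduction` (4.11 with 4.12) no longer rests on this sentence
(`DeJong1996FibrationReduction.of_threeLeaves`, `AlterationsFibrationReductionStein.lean`, over the
Stein base; `DeJong1996FibrationReduction.of_vertexChoice_of_stein`,
`AlterationsFibrationReductionSection.lean`, where for the construction of 4.11 the exceptional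
divisor yields a local section of `f` and `Y' = ℙ^{d-1}` follows without [18]). (2) For the
ABSTRACT conclusion of 4.11 (`DeJong1996.IsLemma411Fibration`, which forgets the construction)
[18] is load-bearing: with `S = ∅`, `X = Y' ×_k ℙ¹` and `f = π ∘ pr₁` for a connected finite
étale `π : Y' → ℙ^d_k`, the sentence forces `π` to be an isomorphism, i.e. it contains
SGA 1 XI 1.1 in every dimension.

## Sources

* A. J. de Jong, *Smoothness, semi-stability and alterations*, Publ. Math. IHÉS 83 (1996) 51–93:
  4.12, pp. 68–69. [DeJong1996]
* A. Grothendieck, M. Raynaud, SGA 1, Exp. X Cor. 2.11, Exp. XI Prop. 1.1. [SGA1]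
* The Stacks Project, Tag 03H2. [StacksProject]
-/

noncomputable section

open CategoryTheory AlgebraicGeometry

namespace Literature.AlgebraicGeometry.Resolution

universe u

open Literature.AlgebraicGeometry.Morphisms Literature.AlgebraicGeometry.FundamentalGroup

/-- **de Jong 1996, 4.12, "all fibres of `f` are geometrically connected"
(`DeJong1996FibresGeometricallyConnected`) from its three open leaves**: Zariski's connectedness
theorem for the Stein factorisation (`steinFactorization_geometricallyConnected`, Stacks 03H2 (1)),
the finite-étaleness of the finite part `Y' → ℙ^{d-1}` (`DeJong1996SteinFactorizationEtale`) and
X 2.11 for projective space (`EtaleCoverHyperplaneSectionConnected`), the case `r = 1` of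
SGA 1 XI 1.1 being proved (`ProjectiveLineSimplyConnected_holds`).
[cite: DeJong1996, 4.12, pp. 68–69] -/
theorem DeJong1996FibresGeometricallyConnected.of_openLeaves
    (hZ : steinFactorization_geometricallyConnected.{u})
    (hE : DeJong1996SteinFactorizationEtale.{u})
    (hH : EtaleCoverHyperplaneSectionConnected.{u}) :
    DeJong1996FibresGeometricallyConnected.{u} :=
  DeJong1996FibresGeometricallyConnected.of_steinEtale_of_simplyConnected hZ hE
    (ProjectiveSpaceSimplyConnected.of_projectiveLine_of_hyperplaneSection
      ProjectiveLineSimplyConnected_holds hH)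

/-- **The sentence for `dim X ≤ 2` needs no X 2.11**: over `ℙ⁰_k` and `ℙ¹_k` the simple
connectedness used in "We conclude that `Y' = ℙ^{d-1}`" is proved in the tree
(`isIso_of_etale_projectiveSpace_zero`, `ProjectiveLineSimplyConnected_holds`), so for `d ≤ 1`
the fibres of `f : X' → ℙ^d_k` are geometrically connected given only Zariski's connectedness
theorem and the finite-étaleness of the Stein finite part. [cite: DeJong1996, 4.12, pp. 68–69] -/
theorem DeJong1996.IsLemma411Fibration.geometricallyConnected_of_le_one
    (hZ : steinFactorization_geometricallyConnected.{u})
    (hE : DeJong1996SteinFactorizationEtale.{u}) {k : Type u} [Field k] [IsAlgClosed k]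
    {X : Scheme.{u}} {fX : X ⟶ Spec (.of k)} {Z : Set X} {d : ℕ} (hd1 : d ≤ 1)
    {X' : Scheme.{u}} {φ : X' ⟶ X} {f : X' ⟶ (Motives.projectiveSpace d k).left}
    (hP : DeJong1996.NormalProjectivePair fX Z) (hd : topologicalKrullDim X = (d + 1 : ℕ))
    (hF : DeJong1996.IsLemma411Fibration fX Z d φ f)
    (hy : ∃ y : ↥(Motives.projectiveSpace d k).left, Smooth (f.fiberToSpecResidueField y)) :
    GeometricallyConnected f := by
  haveI := (hF.isAlteration hP hd).isIntegral
  haveI := hF.isProper hP hd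
  obtain ⟨hfin, het⟩ := hE k X fX Z d X' φ f hP hd hF hy
  haveI := hfin
  haveI := het
  haveI : IsIso f.fromNormalization := by
    obtain rfl | rfl : d = 0 ∨ d = 1 := by omega
    · exact isIso_of_etale_projectiveSpace_zero f.fromNormalization
    · exact ProjectiveLineSimplyConnected_holds k _ f.fromNormalization hfin het inferInstance
  exact hZ.of_isIso_fromNormalization f

end Literature.AlgebraicGeometry.Resolution

end
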